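import Summits.FinalStateConjecture.FinalStateConjecture.Theses.EIHFluxBalance
import Summits.FinalStateConjecture.FinalStateConjecture.Theses.RobustClausewiseGenericity
import Literature.Geometry.Lorentzian.FinalEraPackage2

/-!
# Crux-triage r2 / k1 — evidence file for idea `clausewise-robust-era` (crux item
stmt-FinalStateConjecture-17402, `EIHFluxBalance.ModulatedKerrHandoff` = H′)

JOINT-COSTUME PROBE. The card's line is `H′ ⇐ T ∧ B ∧ E ∧ H ∧ U` with three GENERIC imports in the
robust-escape format of route RobustClausewiseGenericity (RCG): B = `CensorshipRobust'` (= RCG item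
10131), E = `EraRobust`, H = `HyperbolicRobust` (verbatim copies of the ideator's defs from
`Cruxes/ModulatedKerrHandoff/SketchIdeator5r2.lean` below). The card checks that no SINGLE piece gives
H′ or the summit. This file checks the JOINT probe: the three generic imports, ONE pointwise RATE-FREE
re-charting lemma `SoftRechart` (era ∧ censored ∧ hyperbolic pairs ⇒ the Statement's settled clause)
and `MGHDExists` already close the SUMMIT through RCG's PROVED deciding theorem `closes` — with no use
of the trim leg T, of the lift U (the companion card `soft-era-tube-lift`), of H′, or of this route's
engine E′ (`InertialRecession`). Kernel-checked: `summit_of_clausewise_imports`.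

What `SoftRechart` contains (paper, TRIAGE-r2-1.md block 1): (i) under the wall H the era's modulation
law (W4) has an integrable right-hand side `O(t⁻²) + β`, so every worldline velocity converges and
drifts are `o(t)` — the kinematic conclusion of E′ is immediate; (ii) hole charts are re-labelled by
constant Poincaré motions (labels enter `FinalStateDecomposition` only through `poincareInv`, TRIAGE-r1-1/3
relabelling lemma), the flat domain is shrunk diagonally using (F3)/(X3), effacement (H3) gives growing
honest radii, (EX)+(ND) give `HasExhaustiveCharts`; (iii) orientation from the near-horizon pin (H2′)+(EX);
(iv) `RaysStayInClosure` from complete `𝓘⁺` + interior termination; (v) labels are geometric invariants,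
so `Q_S` follows from the era's (P). Items (iii)–(v) are ALSO obligations of the card's own stub U
(`HandoffClause` carries (T), (O), (R), exhaustion) and of E′ (re-charting with `O′ = O`, honest radii,
orientation); none of U's rates (L2 tube capture, L3 tails, the `d^{7/4}` weight, one `C³` lab chart) and
nothing of E′'s flux balance is needed. So under the card's imports the route EIHFluxBalance is a detour.
-/

set_option linter.style.longLine false
set_option linter.dupNamespace false

noncomputable section

namespace Summit.FinalStateConjecture.FinalStateConjecture.Cruxes.ModulatedKerrHandoff.TriageR2K1

open scoped BigOperators Topology Manifold ContDiff ENNReal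
open Filter Set Function TopologicalSpace MeasureTheory Literature.Geometry.Lorentzian InitialDataSet

section Defs

variable (X : Type) [TopologicalSpace X] [ChartedSpace E3 X] [IsManifold (𝓡 3) ((⊤ : ℕ∞) : WithTop ℕ∞) X]
  [T2Space X] [SecondCountableTopology X] [ConnectedSpace X]

/-- Verbatim `ClausewiseRobustEra.TameProbe` (ideator 5, r2). -/
def TameProbe (d : InitialDataSet (𝓡 3) X) (m : ℕ)
    (G : EuclideanSpace ℝ (Fin m) → InitialDataSet (𝓡 3) X) : Prop :=
  IsSmoothDataFamily m G ∧ G 0 = d ∧ (∀ c, G c ∈ admissibleVacuumData X) ∧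
    ∃ K : Set X, IsCompact K ∧ ∀ c, ∀ x ∉ K, (G c).h.inner x = d.h.inner x ∧ (G c).k x = d.k x

/-- Verbatim `ClausewiseRobustEra.RobustlyEscapable` (= the RCG Thesis legend). -/
def RobustlyEscapable (Q : InitialDataSet (𝓡 3) X → Prop) (d : InitialDataSet (𝓡 3) X) : Prop :=
  ∀ (m : ℕ) (G : EuclideanSpace ℝ (Fin m) → InitialDataSet (𝓡 3) X), TameProbe X d m G →
    ∃ (n : ℕ) (G₁ : EuclideanSpace ℝ (Fin n) → InitialDataSet (𝓡 3) X)
      (L : EuclideanSpace ℝ (Fin m) →ₗ[ℝ] EuclideanSpace ℝ (Fin n)),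
      Injective L ∧ TameProbe X d n G₁ ∧ (∀ c, G₁ (L c) = G c) ∧
        ∀ (p : ℕ) (G₂ : EuclideanSpace ℝ (Fin p) → InitialDataSet (𝓡 3) X)
          (L' : EuclideanSpace ℝ (Fin n) →ₗ[ℝ] EuclideanSpace ℝ (Fin p)),
          Injective L' → TameProbe X d p G₂ → (∀ c, G₂ (L' c) = G₁ c) →
            ∃ U : Set (EuclideanSpace ℝ (Fin p)), IsOpen U ∧ Dense U ∧
              ∀ v ∈ U, ∃ δ : ℝ, 0 < δ ∧ ∀ t : ℝ, t ≠ 0 → |t| < δ → Q (G₂ (t • v))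

/-- Verbatim `ClausewiseRobustEra.CensoredProp`. -/
def CensoredProp (D : InitialDataSet (𝓡 3) X) : Prop :=
  ∀ 𝒟 : VacuumCauchyDevelopment D, 𝒟.IsMaximal →
    Summit.FinalStateConjecture.HasCompleteNullInfinity 𝒟.toCauchyDevelopment

/-- Verbatim `ClausewiseRobustEra.EraProp` (the BARE rev-2 era: no `RaysStayInClosure`, no
orientation clauses — unlike DFM's item 17642, which appends both). -/
def EraProp (D : InitialDataSet (𝓡 3) X) : Prop :=
  ∀ 𝒟 : VacuumCauchyDevelopment D, 𝒟.IsMaximal → Nonempty (FinalEraPackage₂ 𝒟.toCauchyDevelopment)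

/-- Verbatim `ClausewiseRobustEra.HyperbolicProp`. -/
def HyperbolicProp (D : InitialDataSet (𝓡 3) X) : Prop :=
  ∀ 𝒟 : VacuumCauchyDevelopment D, 𝒟.IsMaximal →
    ∀ (p : FinalEraPackage₂ 𝒟.toCauchyDevelopment) (i j : Fin p.N), i ≠ j →
      ∃ v : ℝ, 0 < v ∧ ∀ᶠ t in atTop, v * t ≤ ‖p.ξ i t - p.ξ j t‖

/-- RCG's `Q_C` (body of `SettlingRobust`, item 17499), verbatim: the Statement's settled clause
minus sub-extremality. -/
def SettlingProp (D : InitialDataSet (𝓡 3) X) : Prop :=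
  ∀ 𝒟 : VacuumCauchyDevelopment D, 𝒟.IsMaximal →
    ∃ (O : Set 𝒟.carrier) (dd : FinalStateDecomposition 𝒟.toSpacetime O 2),
      O = Summit.FinalStateConjecture.exteriorOf 𝒟.toCauchyDevelopment dd.charted ∧
        Summit.FinalStateConjecture.RaysStayInClosure 𝒟.toCauchyDevelopment O ∧
          Summit.FinalStateConjecture.HasExhaustiveCharts dd ∧
            Summit.FinalStateConjecture.IsFutureOriented dd

/-- RCG's `Q_S` (body of `ThirdLawRobust`, item 10132), verbatim. -/
def ThirdLawProp (D : InitialDataSet (𝓡 3) X) : Prop :=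
  ∀ 𝒟 : VacuumCauchyDevelopment D, 𝒟.IsMaximal →
    ∀ (O : Set 𝒟.carrier) (dd : FinalStateDecomposition 𝒟.toSpacetime O 2),
      O = Summit.FinalStateConjecture.exteriorOf 𝒟.toCauchyDevelopment dd.charted →
        Summit.FinalStateConjecture.HasExhaustiveCharts dd →
          ∀ i, Kerr.IsSubextremal (dd.mass i) (dd.spin i)

end Defs

/-- Verbatim `ClausewiseRobustEra.CensorshipRobust'` (= RCG item 10131, `Iff.rfl` below). -/
def CensorshipRobust' : Prop :=
  ∀ (X : Type) [TopologicalSpace X] [ChartedSpace E3 X] [IsManifold (𝓡 3) ((⊤ : ℕ∞) : WithTop ℕ∞) X]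
    [T2Space X] [SecondCountableTopology X] [ConnectedSpace X],
    ∀ d ∈ admissibleVacuumData X, RobustlyEscapable X (CensoredProp X) d

/-- Verbatim `ClausewiseRobustEra.EraRobust` (the card's stub E). -/
def EraRobust : Prop :=
  ∀ (X : Type) [TopologicalSpace X] [ChartedSpace E3 X] [IsManifold (𝓡 3) ((⊤ : ℕ∞) : WithTop ℕ∞) X]
    [T2Space X] [SecondCountableTopology X] [ConnectedSpace X],
    ∀ d ∈ admissibleVacuumData X, RobustlyEscapable X (EraProp X) d

/-- Verbatim `ClausewiseRobustEra.HyperbolicRobust` (the card's stub H). -/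
def HyperbolicRobust : Prop :=
  ∀ (X : Type) [TopologicalSpace X] [ChartedSpace E3 X] [IsManifold (𝓡 3) ((⊤ : ℕ∞) : WithTop ℕ∞) X]
    [T2Space X] [SecondCountableTopology X] [ConnectedSpace X],
    ∀ d ∈ admissibleVacuumData X, RobustlyEscapable X (HyperbolicProp X) d

/-- Settling, robustly, in the legend's bundled form. -/
def SettlingRobust' : Prop :=
  ∀ (X : Type) [TopologicalSpace X] [ChartedSpace E3 X] [IsManifold (𝓡 3) ((⊤ : ℕ∞) : WithTop ℕ∞) X]
    [T2Space X] [SecondCountableTopology X] [ConnectedSpace X],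
    ∀ d ∈ admissibleVacuumData X, RobustlyEscapable X (SettlingProp X) d

/-- The third law, robustly, in the legend's bundled form. -/
def ThirdLawRobust' : Prop :=
  ∀ (X : Type) [TopologicalSpace X] [ChartedSpace E3 X] [IsManifold (𝓡 3) ((⊤ : ℕ∞) : WithTop ℕ∞) X]
    [T2Space X] [SecondCountableTopology X] [ConnectedSpace X],
    ∀ d ∈ admissibleVacuumData X, RobustlyEscapable X (ThirdLawProp X) d

/-- Faithfulness, as in the sketch: the bundled forms ARE RCG's items 10131 / 17499 / 10132. -/
theorem censorshipRobust'_iff : CensorshipRobust' ↔ Theses.RobustClausewiseGenericity.CensorshipRobust :=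
  Iff.rfl

theorem settlingRobust'_iff : SettlingRobust' ↔ Theses.RobustClausewiseGenericity.SettlingRobust :=
  Iff.rfl

theorem thirdLawRobust'_iff : ThirdLawRobust' ↔ Theses.RobustClausewiseGenericity.ThirdLawRobust :=
  Iff.rfl

section Lattice

variable {X : Type} [TopologicalSpace X] [ChartedSpace E3 X] [IsManifold (𝓡 3) ((⊤ : ℕ∞) : WithTop ℕ∞) X]

/-- Robust escapability is MONOTONE in the property along admissible data (same enrichment, same
direction sets; probe members are admissible by the `Tame` legend). [folklore] -/
theorem RobustlyEscapable.mono {Q Q' : InitialDataSet (𝓡 3) X → Prop} {d : InitialDataSet (𝓡 3) X}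
    (hQQ' : ∀ D ∈ admissibleVacuumData X, Q D → Q' D) (h : RobustlyEscapable X Q d) :
    RobustlyEscapable X Q' d := by
  intro m G hG
  obtain ⟨n, G₁, L, hL, hG₁, hGL, R⟩ := h m G hG
  refine ⟨n, G₁, L, hL, hG₁, hGL, fun p G₂ L' hL' hG₂ hGL' ↦ ?_⟩
  obtain ⟨U, hUo, hUd, hU⟩ := R p G₂ L' hL' hG₂ hGL'
  refine ⟨U, hUo, hUd, fun v hv ↦ ?_⟩
  obtain ⟨δ, hδ, hgood⟩ := hU v hv
  exact ⟨δ, hδ, fun t ht htδ ↦ hQQ' _ (hG₂.2.2.1 _) (hgood t ht htδ)⟩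

/-- Robust escapability is CLOSED UNDER CONJUNCTION (general position: enrich for `Q`, then for `Q'`,
intersect the two open dense direction sets on any further enrichment) — the card's lever, stated as a
lattice property instead of as kick families. [folklore] -/
theorem RobustlyEscapable.and {Q Q' : InitialDataSet (𝓡 3) X → Prop} {d : InitialDataSet (𝓡 3) X}
    (h : RobustlyEscapable X Q d) (h' : RobustlyEscapable X Q' d) :
    RobustlyEscapable X (fun D ↦ Q D ∧ Q' D) d := by
  intro m G hG
  obtain ⟨n₁, G₁, L₁, hL₁, hG₁, hGL₁, R₁⟩ := h m G hG
  obtain ⟨n₂, G₂, L₂, hL₂, hG₂, hGL₂, R₂⟩ := h' n₁ G₁ hG₁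
  refine ⟨n₂, G₂, L₂ ∘ₗ L₁, hL₂.comp hL₁, hG₂, fun c ↦ by rw [LinearMap.comp_apply, hGL₂, hGL₁],
    fun p G₃ L₃ hL₃ hG₃ hGL₃ ↦ ?_⟩
  obtain ⟨U₁, hU₁o, hU₁d, hU₁⟩ := R₁ p G₃ (L₃ ∘ₗ L₂) (hL₃.comp hL₂) hG₃
    (fun c ↦ by rw [LinearMap.comp_apply, hGL₃, hGL₂])
  obtain ⟨U₂, hU₂o, hU₂d, hU₂⟩ := R₂ p G₃ L₃ hL₃ hG₃ hGL₃
  refine ⟨U₁ ∩ U₂, hU₁o.inter hU₂o, hU₁d.inter_of_isOpen_left hU₂d hU₁o, fun v hv ↦ ?_⟩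
  obtain ⟨δ₁, hδ₁, h₁⟩ := hU₁ v hv.1
  obtain ⟨δ₂, hδ₂, h₂⟩ := hU₂ v hv.2
  exact ⟨min δ₁ δ₂, lt_min hδ₁ hδ₂, fun t ht htδ ↦
    ⟨h₁ t ht (htδ.trans_le (min_le_left _ _)), h₂ t ht (htδ.trans_le (min_le_right _ _))⟩⟩

end Lattice


/-! ## The kinematic half of `SoftRechart`, kernel-checked: under the wall, era worldlines are inertial -/

section Inertial

variable {X : Type} [TopologicalSpace X] [ChartedSpace E3 X] [IsManifold (𝓡 3) ((⊤ : ℕ∞) : WithTop ℕ∞) X]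
  [ConnectedSpace X] {D : InitialDataSet (𝓡 3) X} {𝒟 : CauchyDevelopment D}

/-- (W3) ⇒ speeds are bounded by `V` after `T`. [folklore] -/
theorem norm_deriv_ξ_le (p : FinalEraPackage₂ 𝒟) (i : Fin p.N) {t : ℝ} (ht : p.T < t) :
    ‖deriv (p.ξ i) t‖ ≤ p.V := by
  refine norm_deriv_le_of_lip' p.V_nonneg ?_
  filter_upwards [Ioi_mem_nhds ht] with x hx
  rw [mem_Ioi] at hx
  rcases le_total t x with htx | hxt
  · have h := p.norm_sub_le i t x ht.le htx
    rwa [Real.norm_eq_abs, abs_of_nonneg (sub_nonneg.2 htx)]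
  · have h := p.norm_sub_le i x t hx.le hxt
    rw [norm_sub_rev, Real.norm_eq_abs, abs_of_nonpos (sub_nonpos.2 hxt), neg_sub]
    exact h

set_option maxHeartbeats 800000 in
/-- **E′'s kinematic conclusion is free on era ∧ wall developments.** In a rev-2 final era whose
pairs separate linearly (`HyperbolicProp` at this package), the modulation law (W4) bounds every
acceleration by `A t⁻² + β(t)` with `β ∈ L¹`, so every worldline VELOCITY CONVERGES (Cauchy
criterion; `E3` is complete). No flux balance, no Chazy–Marchal–Saari endgame. [folklore] -/
theorem tendsto_deriv_ξ_of_linear_separation (p : FinalEraPackage₂ 𝒟)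
    (hH : ∀ i j : Fin p.N, i ≠ j → ∃ v : ℝ, 0 < v ∧ ∀ᶠ t in atTop, v * t ≤ ‖p.ξ i t - p.ξ j t‖)
    (i : Fin p.N) : ∃ w : E3, Tendsto (deriv (p.ξ i)) atTop (𝓝 w) := by
  -- masses are positive (sub-extremal labels)
  have hM : ∀ l, 0 < p.M l := fun l ↦
    (abs_nonneg (p.a l)).trans_lt (show |p.a l| < p.M l from p.isSubextremal l)
  have hsumM : 0 ≤ ∑ l, p.M l := Finset.sum_nonneg fun l _ ↦ (hM l).le
  -- separation rates, one per partner (dummy `1` for `j = i`)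
  have hv : ∀ j, ∃ v : ℝ, 0 < v ∧ (j ≠ i → ∀ᶠ t in atTop, v * t ≤ ‖p.ξ i t - p.ξ j t‖) := by
    intro j
    by_cases hji : j = i
    · exact ⟨1, one_pos, fun h ↦ (h hji).elim⟩
    · obtain ⟨v, hv, h⟩ := hH i j (Ne.symm hji)
      exact ⟨v, hv, fun _ ↦ h⟩
  choose v hv0 hv using hv
  have hev : ∀ᶠ t in atTop, ∀ j, j ≠ i → v j * t ≤ ‖p.ξ i t - p.ξ j t‖ :=
    eventually_all.2 fun j ↦ by
      by_cases hji : j = i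
      · exact Eventually.of_forall fun t h ↦ (h hji).elim
      · exact (hv j hji).mono fun t ht _ ↦ ht
  obtain ⟨t₀, ht₀⟩ := eventually_atTop.1 (hev.and (eventually_gt_atTop (max p.T 1)))
  have ht₀T : p.T < t₀ := (le_max_left _ _).trans_lt (ht₀ t₀ le_rfl).2
  have ht₀1 : 1 < t₀ := (le_max_right _ _).trans_lt (ht₀ t₀ le_rfl).2
  have ht₀0 : 0 < t₀ := one_pos.trans ht₀1
  -- the constant of the `t⁻²` bound
  set A : ℝ := ∑ j ∈ Finset.univ.erase i,
    p.M j / v j ^ 2 * (1 + p.κ * (2 * p.V ^ 2 + (∑ l, p.M l) / v j)) with hA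
  -- regularity of the worldline
  have hC2 : ContDiff ℝ (1 + 1) (p.ξ i) := by rw [one_add_one_eq_two]; exact p.contDiff_ξ i
  have hC1 : ContDiff ℝ 1 (deriv (p.ξ i)) := (contDiff_succ_iff_deriv.1 hC2).2.2
  have hdiff : Differentiable ℝ (deriv (p.ξ i)) := (contDiff_one_iff_deriv.1 hC1).1
  have hcont : Continuous (deriv (deriv (p.ξ i))) := (contDiff_one_iff_deriv.1 hC1).2
  -- THE POINTWISE ACCELERATION BOUND from (W4) + linear separation
  have key : ∀ t, t₀ ≤ t → ‖deriv (deriv (p.ξ i)) t‖ ≤ A * (t ^ 2)⁻¹ + p.β t := by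
    intro t ht
    obtain ⟨hsep, hmax⟩ := ht₀ t ht
    have hT : p.T < t := (le_max_left _ _).trans_lt hmax
    have h1 : (1 : ℝ) < t := (le_max_right _ _).trans_lt hmax
    have ht0 : 0 < t := one_pos.trans h1
    have hvt : ∀ j, 0 < v j * t := fun j ↦ mul_pos (hv0 j) ht0
    have hdv : ∀ j ∈ Finset.univ.erase i, v j * t ≤ ‖p.ξ i t - p.ξ j t‖ := fun j hj ↦
      hsep j (Finset.mem_erase.1 hj).1
    have hdpos : ∀ j ∈ Finset.univ.erase i, 0 < ‖p.ξ i t - p.ξ j t‖ := fun j hj ↦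
      (hvt j).trans_le (hdv j hj)
    have hcore : ∀ j ∈ Finset.univ.erase i,
        p.M j / ‖p.ξ i t - p.ξ j t‖ ^ 2 ≤ p.M j / v j ^ 2 * (t ^ 2)⁻¹ := by
      intro j hj
      calc p.M j / ‖p.ξ i t - p.ξ j t‖ ^ 2 ≤ p.M j / (v j * t) ^ 2 :=
            div_le_div_of_nonneg_left (hM j).le (pow_pos (hvt j) 2)
              (pow_le_pow_left₀ (hvt j).le (hdv j hj) 2)
        _ = p.M j / v j ^ 2 * (t ^ 2)⁻¹ := by rw [mul_pow]; ring
    -- the Newtonian term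
    have hS : ‖∑ j ∈ Finset.univ.erase i, (p.M j / ‖p.ξ i t - p.ξ j t‖ ^ 3) • (p.ξ i t - p.ξ j t)‖ ≤
        ∑ j ∈ Finset.univ.erase i, p.M j / v j ^ 2 * (t ^ 2)⁻¹ := by
      refine (norm_sum_le _ _).trans (Finset.sum_le_sum fun j hj ↦ ?_)
      rw [norm_smul, Real.norm_eq_abs,
        abs_of_nonneg (div_nonneg (hM j).le (pow_nonneg (norm_nonneg _) 3)),
        show ‖p.ξ i t - p.ξ j t‖ ^ 3 = ‖p.ξ i t - p.ξ j t‖ ^ 2 * ‖p.ξ i t - p.ξ j t‖ from pow_succ _ 2,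
        div_mul_eq_mul_div, mul_div_mul_right _ _ (hdpos j hj).ne']
      exact hcore j hj
    -- the post-Newtonian slack
    have hsi : ‖deriv (p.ξ i) t‖ ≤ p.V := norm_deriv_ξ_le p i hT
    have hR : ∑ j ∈ Finset.univ.erase i, p.M j / ‖p.ξ i t - p.ξ j t‖ ^ 2 *
          (‖deriv (p.ξ i) t‖ ^ 2 + ‖deriv (p.ξ j) t‖ ^ 2 + (∑ l, p.M l) / ‖p.ξ i t - p.ξ j t‖) ≤
        ∑ j ∈ Finset.univ.erase i, p.M j / v j ^ 2 * (t ^ 2)⁻¹ * (2 * p.V ^ 2 + (∑ l, p.M l) / v j) := by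
      refine Finset.sum_le_sum fun j hj ↦ ?_
      have hsj : ‖deriv (p.ξ j) t‖ ≤ p.V := norm_deriv_ξ_le p j hT
      have h1' : ‖deriv (p.ξ i) t‖ ^ 2 ≤ p.V ^ 2 := pow_le_pow_left₀ (norm_nonneg _) hsi 2
      have h2' : ‖deriv (p.ξ j) t‖ ^ 2 ≤ p.V ^ 2 := pow_le_pow_left₀ (norm_nonneg _) hsj 2
      have h3' : (∑ l, p.M l) / ‖p.ξ i t - p.ξ j t‖ ≤ (∑ l, p.M l) / v j :=
        div_le_div_of_nonneg_left hsumM (hv0 j)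
          ((le_mul_of_one_le_right (hv0 j).le h1.le).trans (hdv j hj))
      have hB : ‖deriv (p.ξ i) t‖ ^ 2 + ‖deriv (p.ξ j) t‖ ^ 2 + (∑ l, p.M l) / ‖p.ξ i t - p.ξ j t‖ ≤
          2 * p.V ^ 2 + (∑ l, p.M l) / v j := by linarith
      exact mul_le_mul (hcore j hj) hB
        (add_nonneg (add_nonneg (sq_nonneg _) (sq_nonneg _)) (div_nonneg hsumM (norm_nonneg _)))
        (mul_nonneg (div_nonneg (hM j).le (sq_nonneg _)) (inv_nonneg.2 (sq_nonneg _)))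
    -- the modulation law at `t`, with the two sums abbreviated
    have hmod : ‖deriv (deriv (p.ξ i)) t +
          ∑ j ∈ Finset.univ.erase i, (p.M j / ‖p.ξ i t - p.ξ j t‖ ^ 3) • (p.ξ i t - p.ξ j t)‖ ≤
        p.κ * (∑ j ∈ Finset.univ.erase i, p.M j / ‖p.ξ i t - p.ξ j t‖ ^ 2 *
          (‖deriv (p.ξ i) t‖ ^ 2 + ‖deriv (p.ξ j) t‖ ^ 2 + (∑ l, p.M l) / ‖p.ξ i t - p.ξ j t‖)) + p.β t :=
      p.modulation t hT.le i
    set S : E3 := ∑ j ∈ Finset.univ.erase i, (p.M j / ‖p.ξ i t - p.ξ j t‖ ^ 3) • (p.ξ i t - p.ξ j t)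
      with hSdef
    set R : ℝ := ∑ j ∈ Finset.univ.erase i, p.M j / ‖p.ξ i t - p.ξ j t‖ ^ 2 *
          (‖deriv (p.ξ i) t‖ ^ 2 + ‖deriv (p.ξ j) t‖ ^ 2 + (∑ l, p.M l) / ‖p.ξ i t - p.ξ j t‖) with hRdef
    have e1 : ‖deriv (deriv (p.ξ i)) t‖ ≤ ‖deriv (deriv (p.ξ i)) t + S‖ + ‖S‖ := by
      have h := norm_sub_le (deriv (deriv (p.ξ i)) t + S) S
      rwa [add_sub_cancel_right] at h
    have e2 : ‖deriv (deriv (p.ξ i)) t‖ ≤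
        p.κ * (∑ j ∈ Finset.univ.erase i, p.M j / v j ^ 2 * (t ^ 2)⁻¹ * (2 * p.V ^ 2 + (∑ l, p.M l) / v j)) +
          p.β t + ∑ j ∈ Finset.univ.erase i, p.M j / v j ^ 2 * (t ^ 2)⁻¹ :=
      e1.trans ((add_le_add hmod hS).trans
        (add_le_add (add_le_add (mul_le_mul_of_nonneg_left hR p.κ_nonneg) le_rfl) le_rfl))
    refine e2.trans_eq ?_
    rw [hA, Finset.sum_mul, Finset.mul_sum, add_right_comm, ← Finset.sum_add_distrib]
    congr 1
    exact Finset.sum_congr rfl fun j _ ↦ by ring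
  -- the bound is integrable at infinity
  set g : ℝ → ℝ := fun t ↦ A * (t ^ 2)⁻¹ + p.β t with hg
  have hgi : IntegrableOn g (Ioi t₀) := by
    have h1 : IntegrableOn (fun t : ℝ ↦ A * t ^ (-2 : ℝ)) (Ioi t₀) :=
      Integrable.const_mul (integrableOn_Ioi_rpow_of_lt (by norm_num) ht₀0) A
    have h2 : IntegrableOn (fun t : ℝ ↦ A * (t ^ 2)⁻¹) (Ioi t₀) :=
      h1.congr_fun (fun t ht ↦ by
        rw [mem_Ioi] at ht
        show A * t ^ (-2 : ℝ) = A * (t ^ 2)⁻¹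
        rw [Real.rpow_neg (ht₀0.trans ht).le, Real.rpow_two]) measurableSet_Ioi
    have h3 : IntegrableOn p.β (Ioi t₀) :=
      p.integrableOn_β.mono_set fun t ht ↦ (ht₀T.trans (mem_Ioi.1 ht)).le
    exact Integrable.add h2 h3
  -- primitives from `t₁ := t₀ + 1` converge, hence are Cauchy
  set t₁ : ℝ := t₀ + 1 with ht₁
  have ht₀₁ : t₀ < t₁ := by rw [ht₁]; linarith
  have hsub : ∀ a b : ℝ, t₁ ≤ a → a ≤ b → uIcc a b ⊆ Ioi t₀ := fun a b ha hab ↦ by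
    rw [uIcc_of_le hab]
    exact fun t ht ↦ ht₀₁.trans_le (ha.trans ht.1)
  have hgab : ∀ a b : ℝ, t₁ ≤ a → a ≤ b → IntervalIntegrable g volume a b := fun a b ha hab ↦
    (hgi.mono_set (hsub a b ha hab)).intervalIntegrable
  set G : ℝ → ℝ := fun b ↦ ∫ t in t₁..b, g t with hG
  have hGt : Tendsto G atTop (𝓝 (∫ t in Ioi t₁, g t)) :=
    intervalIntegral_tendsto_integral_Ioi t₁ (hgi.mono_set (Ioi_subset_Ioi ht₀₁.le)) tendsto_id
  have hGc : CauchySeq G := hGt.cauchySeq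
  -- velocity increments are controlled by increments of `G`
  have hbound : ∀ a b : ℝ, t₁ ≤ a → a ≤ b → ‖deriv (p.ξ i) b - deriv (p.ξ i) a‖ ≤ G b - G a := by
    intro a b ha hab
    rw [← intervalIntegral.integral_eq_sub_of_hasDerivAt (fun x _ ↦ (hdiff x).hasDerivAt)
      (hcont.intervalIntegrable a b)]
    calc ‖∫ y in a..b, deriv (deriv (p.ξ i)) y‖
        ≤ ∫ y in a..b, ‖deriv (deriv (p.ξ i)) y‖ := intervalIntegral.norm_integral_le_integral_norm hab
      _ ≤ ∫ y in a..b, g y :=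
          intervalIntegral.integral_mono_on hab (hcont.intervalIntegrable a b).norm (hgab a b ha hab)
            fun x hx ↦ key x ((le_of_lt ht₀₁).trans (ha.trans hx.1))
      _ = G b - G a := by
          rw [eq_sub_iff_add_eq', hG]
          exact intervalIntegral.integral_add_adjacent_intervals (hgab t₁ a le_rfl ha) (hgab a b ha hab)
  have hCauchy : CauchySeq (deriv (p.ξ i)) := by
    refine Metric.cauchySeq_iff.2 fun ε hε ↦ ?_
    obtain ⟨N, hN⟩ := Metric.cauchySeq_iff.1 hGc ε hε
    refine ⟨max N t₁, fun m hm n hn ↦ ?_⟩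
    have hmN : N ≤ m := (le_max_left _ _).trans hm
    have hnN : N ≤ n := (le_max_left _ _).trans hn
    have hm₁ : t₁ ≤ m := (le_max_right _ _).trans hm
    have hn₁ : t₁ ≤ n := (le_max_right _ _).trans hn
    rcases le_total n m with hnm | hmn
    · calc dist (deriv (p.ξ i) m) (deriv (p.ξ i) n) = ‖deriv (p.ξ i) m - deriv (p.ξ i) n‖ := dist_eq_norm _ _
        _ ≤ G m - G n := hbound n m hn₁ hnm
        _ ≤ dist (G m) (G n) := by rw [Real.dist_eq]; exact le_abs_self _
        _ < ε := hN m hmN n hnN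
    · calc dist (deriv (p.ξ i) m) (deriv (p.ξ i) n) = ‖deriv (p.ξ i) n - deriv (p.ξ i) m‖ := by
            rw [dist_comm, dist_eq_norm]
        _ ≤ G n - G m := hbound m n hm₁ hmn
        _ ≤ dist (G n) (G m) := by rw [Real.dist_eq]; exact le_abs_self _
        _ < ε := hN n hnN m hmN
  exact cauchySeq_tendsto_of_complete hCauchy

end Inertial

/-- THE ONE RATE-FREE LEMMA between the card's generic imports and RCG's generic cruxes (POINTWISE in
the admissible datum; no genericity, no rates, no weights, no common `C³` lab chart): a censored datum
all of whose MGHDs carry a bare rev-2 era whose pairs separate linearly SETTLES in the Statement's sense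
(RCG's `Q_C`) with sub-extremal holes in every honest decomposition (RCG's `Q_S`). Content: (W4) + the
wall ⇒ `‖ξ̈ᵢ‖ ≤ C t⁻² + β ∈ L¹` ⇒ inertial worldlines with `o(t)` drifts (E′'s kinematic conclusion, for
free); Poincaré re-labelling of the hole charts; diagonal shrinking of the flat domain by (F3)/(X3);
effacement (H3) ⇒ growing honest radii; (EX)+(ND) ⇒ `HasExhaustiveCharts`; orientation from (H2′)+(EX);
`RaysStayInClosure` from complete `𝓘⁺` + interior termination; Kerr labels are geometric invariants ⇒
`Q_S` from (P). Every non-formal item in this list is ALSO inside the card's own stub `SoftEraLift`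
(whose `HandoffClause` carries (T), (O), (R), exhaustion from the SAME bare era) or inside E′. -/
def SoftRechart : Prop :=
  ∀ (X : Type) [TopologicalSpace X] [ChartedSpace E3 X] [IsManifold (𝓡 3) ((⊤ : ℕ∞) : WithTop ℕ∞) X]
    [T2Space X] [SecondCountableTopology X] [ConnectedSpace X],
    ∀ D ∈ admissibleVacuumData X,
      CensoredProp X D → EraProp X D → HyperbolicProp X D → SettlingProp X D ∧ ThirdLawProp X D

/-- The card's three generic imports plus `SoftRechart` give RCG's two remaining generic cruxes
(`SettlingRobust`, `ThirdLawRobust`) BY NAME. [folklore] -/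
theorem rcg_cruxes_of_clausewise_imports (hR : SoftRechart) (hB : CensorshipRobust') (hE : EraRobust)
    (hH : HyperbolicRobust) :
    Theses.RobustClausewiseGenericity.SettlingRobust ∧ Theses.RobustClausewiseGenericity.ThirdLawRobust := by
  have key : ∀ (X : Type) [TopologicalSpace X] [ChartedSpace E3 X]
      [IsManifold (𝓡 3) ((⊤ : ℕ∞) : WithTop ℕ∞) X] [T2Space X] [SecondCountableTopology X]
      [ConnectedSpace X], ∀ d ∈ admissibleVacuumData X,
      RobustlyEscapable X (fun D ↦ SettlingProp X D ∧ ThirdLawProp X D) d := by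
    intro X _ _ _ _ _ _ d hd
    exact (((hB X d hd).and (hE X d hd)).and (hH X d hd)).mono
      fun D hD h ↦ hR X D hD h.1.1 h.1.2 h.2
  exact ⟨settlingRobust'_iff.1 fun X _ _ _ _ _ _ d hd ↦ (key X d hd).mono fun _ _ h ↦ h.1,
    thirdLawRobust'_iff.1 fun X _ _ _ _ _ _ d hd ↦ (key X d hd).mono fun _ _ h ↦ h.2⟩

/-- **JOINT COSTUME, kernel-checked.** Under the card's three generic imports (B = RCG 10131, E, H),
ONE pointwise rate-free re-charting lemma and MGHD existence (RCG 9937, the summit's own anti-vacuity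
conjunct), the SUMMIT closes through RCG's proved deciding theorem — without the trim leg T, without the
lift U (card `soft-era-tube-lift`), without H′ and without E′: route EIHFluxBalance is bypassed.
[folklore] -/
theorem summit_of_clausewise_imports (hR : SoftRechart)
    (hM : Theses.RobustClausewiseGenericity.MGHDExists) (hB : CensorshipRobust') (hE : EraRobust)
    (hH : HyperbolicRobust) : _root_.FinalStateConjecture :=
  have h := rcg_cruxes_of_clausewise_imports hR hB hE hH
  Theses.RobustClausewiseGenericity.closes h.1 (censorshipRobust'_iff.1 hB) h.2 hM

end Summit.FinalStateConjecture.FinalStateConjecture.Cruxes.ModulatedKerrHandoff.TriageR2K1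

end
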